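import Summits.HubbardSuperconductivity.HubbardSuperconductivity.Theorems.NodalWardXYPerturbedXYOrderWardIdentity

/-!
# `PerturbedXYOrder` (stmt-HubbardSuperconductivity-10739) — line `schwarz-inheritance`, tools for stub `stub_twistedJensenBound` (I)

Tools for the NEGATIVE stub `stub_invariantMeanFieldPinching` of lead c19 (Goldstone pinching: the O(2)-INVARIANT mean-field
source `s |M|²/N` is not uniformly zero-free at low temperature — `Theorems/PerturbedXYOrder/Negative/InvariantMeanFieldPinching.lean`),
over the vocabulary of `Theorems/NodalWardXYDefs.lean` (`(wJ J θ).re = e^{J Σ_b cos ∇_bθ}` is the real rotator weight):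

* §A `gp_jensen` — Jensen's inequality for the rotator state in tangent-line form:
  `⟨Ψ⟩_J ≤ log ⟨e^Ψ⟩_J`, `⟨F⟩_J := ∫_cube F w_J / ∫_cube w_J`;
* §B `gp_setIntegral_twist`, `gp_twisted_jensen`, `gp_twisted_jensen_symm` — the **twisted Gibbs variational bound**
  (Mermin–Wagner twist as a trial state): for every site-dependent rotation `g : Λ → ℝ` and every continuous function `F` of the spins,
  `log ⟨e^{F}⟩_J ≥ ⟨½(F∘τ_g + F∘τ_{−g})⟩_J − J Σ_b (1 − cos ∇_b g)`
  (rotation invariance of Lebesgue measure on the angle cube, `cfw_setIntegral_rotate`, then §A; the symmetrisation `±g` kills the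
  odd part of the energy shift and `cos ∇θ (cos ∇g − 1) ≥ −(1 − cos ∇g)` bounds the even part);

Companions: `Theorems/NodalWardXYPerturbedXYOrderCharacterSum.lean` (the axial twists `g_k = 2πk x₀/L`, their cost, and the
character-sum bound on the twisted two-point sums) and `Theorems/NodalWardXYPerturbedXYOrderMeanFieldBounds.lean` (the assembled
real lower bounds for the mean-field source, registered stub `stub_twistedJensenBound`).
-/

noncomputable section

namespace Summit.HubbardSuperconductivity.HubbardSuperconductivity.Theorems.PerturbedXYOrder

open MeasureTheory Literature.Probability.LatticeModels Metric Set
open Summit.HubbardSuperconductivity.HubbardSuperconductivity.Theses.NodalWardXY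

variable {L : ℕ}

/-! ### A. Jensen's inequality for the rotator state -/

/-- The real rotator weight is the real part of `wJ`. -/
theorem gp_wJ_re [NeZero L] (J : ℝ) (θ : TorusSite 3 L → ℝ) :
    (wJ J θ).re = Real.exp (J * ∑ b : Bond L, Real.cos (θ (b.1 + Pi.single b.2 1) - θ b.1)) := rfl

/-- The real rotator weight is positive. -/
theorem gp_wJ_re_pos [NeZero L] (J : ℝ) (θ : TorusSite 3 L → ℝ) : 0 < (wJ J θ).re := by
  rw [gp_wJ_re]; exact Real.exp_pos _

/-- The real rotator weight is continuous. -/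
theorem gp_continuous_wJ_re [NeZero L] (J : ℝ) : Continuous fun θ : TorusSite 3 L → ℝ => (wJ J θ).re :=
  Complex.continuous_re.comp (ent_continuous_wJ J)

/-- The real partition function `∫_cube w_J` is positive. -/
theorem gp_integral_wJ_re_pos [NeZero L] (J : ℝ) : 0 < ∫ θ in cube L, (wJ J θ).re :=
  integral_xyWeight_pos J

/-- Continuous functions are integrable on the cube. -/
theorem gp_integrable [NeZero L] {f : (TorusSite 3 L → ℝ) → ℝ} (hf : Continuous f) :
    Integrable f (volume.restrict (cube L)) :=
  hf.continuousOn.integrableOn_compact ent_isCompact_cube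

/-- **Jensen's inequality for the rotator state** (tangent-line form): for continuous real `Ψ`,
`∫ Ψ w_J / ∫ w_J ≤ log (∫ e^Ψ w_J / ∫ w_J)` (`e^Ψ ≥ e^c (1 + Ψ − c)` at `c = ⟨Ψ⟩`). [folklore] -/
theorem gp_jensen [NeZero L] (J : ℝ) {Ψ : (TorusSite 3 L → ℝ) → ℝ} (hΨ : Continuous Ψ) :
    (∫ θ in cube L, Ψ θ * (wJ J θ).re) / (∫ θ in cube L, (wJ J θ).re) ≤
      Real.log ((∫ θ in cube L, Real.exp (Ψ θ) * (wJ J θ).re) / ∫ θ in cube L, (wJ J θ).re) := by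
  have hwc : Continuous fun θ : TorusSite 3 L → ℝ => (wJ J θ).re := gp_continuous_wJ_re J
  have hZ : 0 < ∫ θ in cube L, (wJ J θ).re := gp_integral_wJ_re_pos J
  set c : ℝ := (∫ θ in cube L, Ψ θ * (wJ J θ).re) / ∫ θ in cube L, (wJ J θ).re with hc
  have hpt : ∀ θ : TorusSite 3 L → ℝ,
      Real.exp c * (wJ J θ).re + Real.exp c * ((Ψ θ - c) * (wJ J θ).re) ≤ Real.exp (Ψ θ) * (wJ J θ).re := by
    intro θ
    have h1 := Real.add_one_le_exp (Ψ θ - c)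
    have hwθ : 0 ≤ (wJ J θ).re := (gp_wJ_re_pos J θ).le
    calc Real.exp c * (wJ J θ).re + Real.exp c * ((Ψ θ - c) * (wJ J θ).re)
        = Real.exp c * ((Ψ θ - c) + 1) * (wJ J θ).re := by ring
      _ ≤ Real.exp c * Real.exp (Ψ θ - c) * (wJ J θ).re := by gcongr
      _ = Real.exp (Ψ θ) * (wJ J θ).re := by rw [← Real.exp_add]; congr 1; ring_nf
  have hI1 : Integrable (fun θ => Real.exp c * (wJ J θ).re) (volume.restrict (cube L)) :=
    (gp_integrable hwc).const_mul _
  have hI2 : Integrable (fun θ => Real.exp c * ((Ψ θ - c) * (wJ J θ).re)) (volume.restrict (cube L)) :=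
    (gp_integrable ((hΨ.sub continuous_const).mul hwc)).const_mul _
  have hI12 : Integrable (fun θ => Real.exp c * (wJ J θ).re + Real.exp c * ((Ψ θ - c) * (wJ J θ).re))
      (volume.restrict (cube L)) := hI1.add hI2
  have hI3 : Integrable (fun θ => Real.exp (Ψ θ) * (wJ J θ).re) (volume.restrict (cube L)) :=
    gp_integrable ((Real.continuous_exp.comp hΨ).mul hwc)
  have hmono := integral_mono hI12 hI3 hpt
  rw [integral_add hI1 hI2, integral_const_mul, integral_const_mul] at hmono
  have hzero : ∫ θ in cube L, (Ψ θ - c) * (wJ J θ).re = 0 := by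
    have hI4 : Integrable (fun θ => Ψ θ * (wJ J θ).re) (volume.restrict (cube L)) := gp_integrable (hΨ.mul hwc)
    have hI5 : Integrable (fun θ => c * (wJ J θ).re) (volume.restrict (cube L)) := (gp_integrable hwc).const_mul _
    have : (fun θ : TorusSite 3 L → ℝ => (Ψ θ - c) * (wJ J θ).re) = fun θ => Ψ θ * (wJ J θ).re - c * (wJ J θ).re := by
      funext θ; ring
    rw [this, integral_sub hI4 hI5, integral_const_mul, hc]
    field_simp
    ring
  rw [hzero, mul_zero, add_zero] at hmono
  -- `exp c * Z ≤ ∫ e^Ψ w`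
  rw [Real.le_log_iff_exp_le (div_pos_iff.2 (Or.inl ⟨lt_of_lt_of_le (mul_pos (Real.exp_pos c) hZ) hmono, hZ⟩)),
    le_div_iff₀ hZ]
  exact hmono

/-! ### B. The twisted Gibbs variational bound -/

/-- **Rotating the rotator integral.** For a continuous function `F` of the spins and a site-dependent rotation `g`,
`∫_cube e^{F(e^{iθ})} w_J(θ) dθ = ∫_cube e^{F(e^{i(θ+g)})} w_J(θ + g) dθ` (Lebesgue measure on the angle cube is rotation invariant,
`cfw_setIntegral_rotate`). [folklore] -/
theorem gp_setIntegral_twist [NeZero L] (J : ℝ) (g : TorusSite 3 L → ℝ) {F : (TorusSite 3 L → Circle) → ℝ} (hF : Continuous F) :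
    ∫ θ in cube L, Real.exp (F (fun v => Circle.exp (θ v))) * (wJ J θ).re =
      ∫ θ in cube L, Real.exp (F (fun v => Circle.exp (θ v + g v))) *
        Real.exp (J * ∑ b : Bond L,
          Real.cos ((θ (b.1 + Pi.single b.2 1) + g (b.1 + Pi.single b.2 1)) - (θ b.1 + g b.1))) := by
  set χ : Bond L → (TorusSite 3 L → Circle) →ₜ* Circle := fun b => diffChar b.1 (b.1 + Pi.single b.2 1) with hχ
  set G : (TorusSite 3 L → Circle) → ℝ := fun z => Real.exp (F z) * ginibreWeight χ (fun _ => J) z with hG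
  have hGc : Continuous G := (Real.continuous_exp.comp hF).mul (continuous_ginibreWeight χ _)
  have key := cfw_setIntegral_rotate g hGc
  have hR : ∀ θ : TorusSite 3 L → ℝ, G (fun v => Circle.exp (θ v)) = Real.exp (F (fun v => Circle.exp (θ v))) * (wJ J θ).re := by
    intro θ
    simp only [hG, hχ, cfw_ginibreWeight_exp, gp_wJ_re]
  have hL' : ∀ θ : TorusSite 3 L → ℝ, G (fun v => Circle.exp (θ v + g v)) =
      Real.exp (F (fun v => Circle.exp (θ v + g v))) *
        Real.exp (J * ∑ b : Bond L,
          Real.cos ((θ (b.1 + Pi.single b.2 1) + g (b.1 + Pi.single b.2 1)) - (θ b.1 + g b.1))) := by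
    intro θ
    have h := cfw_ginibreWeight_exp (L := L) J (fun v => θ v + g v)
    simp only [hG, hχ]
    rw [h]
  calc ∫ θ in cube L, Real.exp (F (fun v => Circle.exp (θ v))) * (wJ J θ).re
      = ∫ θ in cube L, G (fun v => Circle.exp (θ v)) := integral_congr_ae (ae_of_all _ fun θ => (hR θ).symm)
    _ = ∫ θ in cube L, G (fun v => Circle.exp (θ v + g v)) := key.symm
    _ = _ := integral_congr_ae (ae_of_all _ fun θ => hL' θ)

/-- **Twisted Jensen bound.** For a continuous function `F` of the spins and any site-dependent rotation `g`,
`log (∫ e^{F(e^{iθ})} w_J / ∫ w_J) ≥ ⟨F(e^{i(θ+g)}) + J Σ_b (cos(∇_bθ + ∇_bg) − cos ∇_bθ)⟩_J`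
(rotate by `g`, then Jensen with `Ψ = F∘τ_g + log(w_J∘τ_g / w_J)`: the Gibbs variational principle with the rotated state as trial
state). [folklore] -/
theorem gp_twisted_jensen [NeZero L] (J : ℝ) (g : TorusSite 3 L → ℝ) {F : (TorusSite 3 L → Circle) → ℝ} (hF : Continuous F) :
    (∫ θ in cube L, (F (fun v => Circle.exp (θ v + g v)) +
        J * ∑ b : Bond L, (Real.cos ((θ (b.1 + Pi.single b.2 1) + g (b.1 + Pi.single b.2 1)) - (θ b.1 + g b.1)) -
          Real.cos (θ (b.1 + Pi.single b.2 1) - θ b.1))) * (wJ J θ).re) / (∫ θ in cube L, (wJ J θ).re) ≤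
      Real.log ((∫ θ in cube L, Real.exp (F (fun v => Circle.exp (θ v))) * (wJ J θ).re) / ∫ θ in cube L, (wJ J θ).re) := by
  set Ψ : (TorusSite 3 L → ℝ) → ℝ := fun θ => F (fun v => Circle.exp (θ v + g v)) +
      J * ∑ b : Bond L, (Real.cos ((θ (b.1 + Pi.single b.2 1) + g (b.1 + Pi.single b.2 1)) - (θ b.1 + g b.1)) -
        Real.cos (θ (b.1 + Pi.single b.2 1) - θ b.1)) with hΨ
  have hΨc : Continuous Ψ := by
    refine Continuous.add ?_ (by fun_prop)
    refine hF.comp (continuous_pi fun v => Circle.exp.continuous.comp ?_)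
    exact (continuous_apply v).add continuous_const
  have hJ := gp_jensen (L := L) J hΨc
  have hexp : ∀ θ : TorusSite 3 L → ℝ, Real.exp (Ψ θ) * (wJ J θ).re =
      Real.exp (F (fun v => Circle.exp (θ v + g v))) *
        Real.exp (J * ∑ b : Bond L,
          Real.cos ((θ (b.1 + Pi.single b.2 1) + g (b.1 + Pi.single b.2 1)) - (θ b.1 + g b.1))) := by
    intro θ
    rw [hΨ, gp_wJ_re]
    simp only [Finset.sum_sub_distrib]
    rw [← Real.exp_add, ← Real.exp_add]
    congr 1
    ring
  have hrw : ∫ θ in cube L, Real.exp (Ψ θ) * (wJ J θ).re =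
      ∫ θ in cube L, Real.exp (F (fun v => Circle.exp (θ v))) * (wJ J θ).re := by
    rw [gp_setIntegral_twist J g hF]
    exact integral_congr_ae (ae_of_all _ fun θ => hexp θ)
  rw [hrw] at hJ
  exact hJ

/-- `cos a (cos d − 1) ≥ −(1 − cos d)`: the even part of the energy shift under a twist is bounded by the twist's own cost. -/
theorem gp_cos_twist_even (a d : ℝ) :
    -(2 * (1 - Real.cos d)) ≤ Real.cos (a + d) - Real.cos a + (Real.cos (a - d) - Real.cos a) := by
  rw [Real.cos_add, Real.cos_sub]
  nlinarith [Real.cos_le_one a, Real.cos_le_one d, mul_nonneg (sub_nonneg.2 (Real.cos_le_one a)) (sub_nonneg.2 (Real.cos_le_one d))]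

/-- **Symmetrised twisted Jensen bound.** For `J ≥ 0`, a continuous function `F` of the spins and any site-dependent rotation `g`,
`log (∫ e^{F(e^{iθ})} w_J / ∫ w_J) ≥ ⟨½ (F(e^{i(θ+g)}) + F(e^{i(θ−g)}))⟩_J − J Σ_b (1 − cos ∇_b g)`
(average of `gp_twisted_jensen` at `g` and `−g`; the odd part `⟨sin ∇θ⟩ sin ∇g` of the energy shift cancels and the even part
`⟨cos ∇θ⟩ (cos ∇g − 1)` is at least `−(1 − cos ∇g)`).  This is the Mermin–Wagner twist as a trial state in the Gibbs variational
principle: a slowly varying twist costs only `J Σ_b (1 − cos ∇_b g)`. [folklore] -/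
theorem gp_twisted_jensen_symm [NeZero L] {J : ℝ} (hJ : 0 ≤ J) (g : TorusSite 3 L → ℝ)
    {F : (TorusSite 3 L → Circle) → ℝ} (hF : Continuous F) :
    (∫ θ in cube L, (F (fun v => Circle.exp (θ v + g v)) + F (fun v => Circle.exp (θ v - g v))) / 2 * (wJ J θ).re) /
        (∫ θ in cube L, (wJ J θ).re) -
      J * ∑ b : Bond L, (1 - Real.cos (g (b.1 + Pi.single b.2 1) - g b.1)) ≤
      Real.log ((∫ θ in cube L, Real.exp (F (fun v => Circle.exp (θ v))) * (wJ J θ).re) / ∫ θ in cube L, (wJ J θ).re) := by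
  have hwc : Continuous fun θ : TorusSite 3 L → ℝ => (wJ J θ).re := gp_continuous_wJ_re J
  have hZ : 0 < ∫ θ in cube L, (wJ J θ).re := gp_integral_wJ_re_pos J
  have h1 := gp_twisted_jensen (L := L) J g hF
  have h2 := gp_twisted_jensen (L := L) J (fun v => -g v) hF
  -- the two integrands and the symmetrised lower integrand
  set A₁ : (TorusSite 3 L → ℝ) → ℝ := fun θ => (F (fun v => Circle.exp (θ v + g v)) +
      J * ∑ b : Bond L, (Real.cos ((θ (b.1 + Pi.single b.2 1) + g (b.1 + Pi.single b.2 1)) - (θ b.1 + g b.1)) -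
        Real.cos (θ (b.1 + Pi.single b.2 1) - θ b.1))) * (wJ J θ).re with hA₁
  set A₂ : (TorusSite 3 L → ℝ) → ℝ := fun θ => (F (fun v => Circle.exp (θ v + -g v)) +
      J * ∑ b : Bond L, (Real.cos ((θ (b.1 + Pi.single b.2 1) + -g (b.1 + Pi.single b.2 1)) - (θ b.1 + -g b.1)) -
        Real.cos (θ (b.1 + Pi.single b.2 1) - θ b.1))) * (wJ J θ).re with hA₂
  set C : ℝ := J * ∑ b : Bond L, (1 - Real.cos (g (b.1 + Pi.single b.2 1) - g b.1)) with hC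
  set B : (TorusSite 3 L → ℝ) → ℝ := fun θ =>
    ((F (fun v => Circle.exp (θ v + g v)) + F (fun v => Circle.exp (θ v - g v))) - 2 * C) * (wJ J θ).re with hB
  have hcF : ∀ s : TorusSite 3 L → ℝ, Continuous fun θ : TorusSite 3 L → ℝ => F (fun v => Circle.exp (θ v + s v)) := by
    intro s
    refine hF.comp (continuous_pi fun v => Circle.exp.continuous.comp ?_)
    exact (continuous_apply v).add continuous_const
  have hcF' : Continuous fun θ : TorusSite 3 L → ℝ => F (fun v => Circle.exp (θ v - g v)) := by
    have := hcF fun v => -g v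
    simp only [← sub_eq_add_neg] at this
    exact this
  have hA₁c : Continuous A₁ := ((hcF g).add (by fun_prop)).mul hwc
  have hA₂c : Continuous A₂ := ((hcF fun v => -g v).add (by fun_prop)).mul hwc
  have hBc : Continuous B := (((hcF g).add hcF').sub continuous_const).mul hwc
  -- pointwise: `B ≤ A₁ + A₂`
  have hpt : ∀ θ, B θ ≤ A₁ θ + A₂ θ := by
    intro θ
    have hwθ : 0 ≤ (wJ J θ).re := (gp_wJ_re_pos J θ).le
    have hsum : -(2 * ∑ b : Bond L, (1 - Real.cos (g (b.1 + Pi.single b.2 1) - g b.1))) ≤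
        ∑ b : Bond L, (Real.cos ((θ (b.1 + Pi.single b.2 1) + g (b.1 + Pi.single b.2 1)) - (θ b.1 + g b.1)) -
          Real.cos (θ (b.1 + Pi.single b.2 1) - θ b.1)) +
        ∑ b : Bond L, (Real.cos ((θ (b.1 + Pi.single b.2 1) + -g (b.1 + Pi.single b.2 1)) - (θ b.1 + -g b.1)) -
          Real.cos (θ (b.1 + Pi.single b.2 1) - θ b.1)) := by
      rw [Finset.mul_sum, ← Finset.sum_neg_distrib, ← Finset.sum_add_distrib]
      refine Finset.sum_le_sum fun b _ => ?_
      have h := gp_cos_twist_even (θ (b.1 + Pi.single b.2 1) - θ b.1) (g (b.1 + Pi.single b.2 1) - g b.1)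
      have e1 : (θ (b.1 + Pi.single b.2 1) + g (b.1 + Pi.single b.2 1)) - (θ b.1 + g b.1) =
          (θ (b.1 + Pi.single b.2 1) - θ b.1) + (g (b.1 + Pi.single b.2 1) - g b.1) := by ring
      have e2 : (θ (b.1 + Pi.single b.2 1) + -g (b.1 + Pi.single b.2 1)) - (θ b.1 + -g b.1) =
          (θ (b.1 + Pi.single b.2 1) - θ b.1) - (g (b.1 + Pi.single b.2 1) - g b.1) := by ring
      rw [e1, e2]
      linarith
    have hF2 : F (fun v => Circle.exp (θ v - g v)) = F (fun v => Circle.exp (θ v + -g v)) := by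
      simp only [sub_eq_add_neg]
    have key : (F (fun v => Circle.exp (θ v + g v)) + F (fun v => Circle.exp (θ v - g v))) - 2 * C ≤
        (F (fun v => Circle.exp (θ v + g v)) +
          J * ∑ b : Bond L, (Real.cos ((θ (b.1 + Pi.single b.2 1) + g (b.1 + Pi.single b.2 1)) - (θ b.1 + g b.1)) -
            Real.cos (θ (b.1 + Pi.single b.2 1) - θ b.1))) +
        (F (fun v => Circle.exp (θ v + -g v)) +
          J * ∑ b : Bond L, (Real.cos ((θ (b.1 + Pi.single b.2 1) + -g (b.1 + Pi.single b.2 1)) - (θ b.1 + -g b.1)) -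
            Real.cos (θ (b.1 + Pi.single b.2 1) - θ b.1))) := by
      rw [hF2, hC]
      have := mul_le_mul_of_nonneg_left hsum hJ
      nlinarith [this]
    have := mul_le_mul_of_nonneg_right key hwθ
    simpa only [hB, hA₁, hA₂, add_mul] using this
  have hmono : ∫ θ in cube L, B θ ≤ ∫ θ in cube L, (A₁ θ + A₂ θ) :=
    integral_mono (gp_integrable hBc) ((gp_integrable hA₁c).add (gp_integrable hA₂c)) hpt
  rw [integral_add (gp_integrable hA₁c) (gp_integrable hA₂c)] at hmono
  -- evaluate `∫ B = 2 X - 2 C Z`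
  set X : ℝ := ∫ θ in cube L, (F (fun v => Circle.exp (θ v + g v)) + F (fun v => Circle.exp (θ v - g v))) / 2 *
    (wJ J θ).re with hX
  set Z : ℝ := ∫ θ in cube L, (wJ J θ).re with hZdef
  have hIB : ∫ θ in cube L, B θ = 2 * X - 2 * C * Z := by
    have hI1 : Integrable (fun θ => (F (fun v => Circle.exp (θ v + g v)) + F (fun v => Circle.exp (θ v - g v))) *
        (wJ J θ).re) (volume.restrict (cube L)) := gp_integrable (((hcF g).add hcF').mul hwc)
    have hI2 : Integrable (fun θ => 2 * C * (wJ J θ).re) (volume.restrict (cube L)) := (gp_integrable hwc).const_mul _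
    have hsplit : (fun θ => B θ) = fun θ =>
        (F (fun v => Circle.exp (θ v + g v)) + F (fun v => Circle.exp (θ v - g v))) * (wJ J θ).re -
          2 * C * (wJ J θ).re := by
      funext θ; simp only [hB]; ring
    have hhalf : X = (1 / 2) * ∫ θ in cube L,
        (F (fun v => Circle.exp (θ v + g v)) + F (fun v => Circle.exp (θ v - g v))) * (wJ J θ).re := by
      rw [hX, ← integral_const_mul]
      refine integral_congr_ae (ae_of_all _ fun θ => ?_)
      simp only
      ring
    rw [hsplit, integral_sub hI1 hI2, integral_const_mul, hhalf]
    ring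
  rw [hIB] at hmono
  -- divide by `Z > 0` and combine with `h1`, `h2`
  have h := div_le_div_of_nonneg_right hmono hZ.le
  have e : (2 * X - 2 * C * Z) / Z = 2 * (X / Z) - 2 * C := by
    field_simp
  rw [e, add_div] at h
  have e1 : (∫ θ in cube L, A₁ θ) / Z ≤
      Real.log ((∫ θ in cube L, Real.exp (F (fun v => Circle.exp (θ v))) * (wJ J θ).re) / Z) := h1
  have e2 : (∫ θ in cube L, A₂ θ) / Z ≤
      Real.log ((∫ θ in cube L, Real.exp (F (fun v => Circle.exp (θ v))) * (wJ J θ).re) / Z) := h2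
  linarith

/-- STUB `stub_twistedJensenSymm` (registered on stmt-HubbardSuperconductivity-10739, line `schwarz-inheritance`, lead c19): the
**symmetrised twisted Gibbs variational bound** — for `J ≥ 0`, any site-dependent rotation `g` and any continuous function `F` of the spins,
`log ⟨e^{F}⟩_J ≥ ⟨½(F∘τ_g + F∘τ_{−g})⟩_J − J Σ_b (1 − cos ∇_b g)` (= `gp_twisted_jensen_symm`). [folklore] -/
theorem stub_twistedJensenSymm : ∀ (J : ℝ), 0 ≤ J → ∀ (L : ℕ) [NeZero L] (g : TorusSite 3 L → ℝ) (F : (TorusSite 3 L → Circle) → ℝ), Continuous F → (∫ θ in cube L, (F (fun v => Circle.exp (θ v + g v)) + F (fun v => Circle.exp (θ v - g v))) / 2 * (wJ J θ).re) / (∫ θ in cube L, (wJ J θ).re) - J * ∑ b : Bond L, (1 - Real.cos (g (b.1 + Pi.single b.2 1) - g b.1)) ≤ Real.log ((∫ θ in cube L, Real.exp (F (fun v => Circle.exp (θ v))) * (wJ J θ).re) / ∫ θ in cube L, (wJ J θ).re) :=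
  fun _J hJ _L _ g _F hF => gp_twisted_jensen_symm hJ g hF

end Summit.HubbardSuperconductivity.HubbardSuperconductivity.Theorems.PerturbedXYOrder

end
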